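import Summits.HodgeConjecture.HodgeConjecture.Theorems.MarkmanPartnerTransportPicardThreeK3SquaresRealMultiplicationRanks

/-!
# Route MarkmanPartnerTransport · crux `PicardThreeK3Squares` (stmt-HodgeConjecture-19652) —
# field lemma: a totally real `End_Hdg` of a K3-type Hodge structure of rank `≤ 11` containing a square
# root of a non-square natural number `q` is `ℚ(√q)`

The `q`-version of `…PicardTwelveSqrtTwoField` (gen 3, `q = 2`), for the `√3`-sector (symplectic automorphisms
of order `3`, Varesco 2023 Thm. 2.15 / Rem. 2.16) and any further `√q`: for `H` irreducible of K3 type,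
polarized, with `E = End_Hdg(V)` a field all of whose embeddings are real (Zarhin's totally real case),
`dim_ℚ V ≤ 11`, and `t ∈ E` with `t² = q`, `q ∈ ℕ` NOT a square, every element of `E` is `a + b t`
(`a, b ∈ ℚ`): van Geemen's Lemma 3.2 (`RealMultiplicationRanks.exists_three_le_finrank_eq_mul`:
`dim V = [E:ℚ]·m`, `m ≥ 3`) gives `[E:ℚ] ≤ 3`, the minimal polynomial of `t` is `X² − q` (`√q ∉ ℚ`,
Mathlib `irrational_sqrt_natCast_iff`), so `[ℚ(t):ℚ] = 2 ∣ [E:ℚ]` (tower law) and `{1, t}` is a basis.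

* `exists_eq_algebraMap_add_smul_of_mul_self_eq_natCast` — the lemma.

No definition, no named fact, no sorry. Prover seat hodge-nonav-19652-p1 (gen 4),
`--supports stmt-HodgeConjecture-19652`.

References: B. van Geemen, Michigan Math. J. 56 (2008), Lemma 3.2; Yu. G. Zarhin, J. reine angew. Math.
341 (1983), Thm. 1.6; M. Varesco, Math. Z. 305 (2023), Rem. 2.10 and Rem. 2.16.
-/

set_option linter.dupNamespace false

noncomputable section

namespace Summit.HodgeConjecture.HodgeConjecture.Theorems.MarkmanPartnerTransport.NikulinIsogeny

open scoped IntermediateField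
open Module
open Literature.AlgebraicGeometry.Motives Literature.AlgebraicGeometry.Motives.HodgeStructure
open Summit.HodgeConjecture.HodgeConjecture.Theorems.MarkmanPartnerTransport.RealMultiplicationRanks

/-! ### Abstract carrier: a totally real `End_Hdg` containing `√q` at rank `≤ 11` is `ℚ(√q)` -/

section Abstract

variable {V : Type*} [AddCommGroup V] [Module ℚ V] [Module.Finite ℚ V] {H : HodgeStructure V 2}

/-- **A totally real endomorphism field containing a square root of a non-square `q ∈ ℕ` is `ℚ(√q)`
when `dim_ℚ V ≤ 11`.** For `H` irreducible of K3 type, polarized, with `E = End_Hdg(V)` a field all of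
whose embeddings are real, `dim_ℚ V ≤ 11`, and `t ∈ E` with `t² = q`: every element of `E` is `a + b t`
(`a, b ∈ ℚ`). Van Geemen: `dim V = [E:ℚ]·m`, `m ≥ 3`, so `[E:ℚ] ≤ 3`; `[ℚ(t):ℚ] = 2` (`X² − q` is the
minimal polynomial, `√q ∉ ℚ`) divides `[E:ℚ]` (tower law), so `[E:ℚ] = 2` and `{1, t}` is a basis.
[cite: Vangeemen2008, Lemma 3.2] [cite: Zarhin1983HodgeGroupsK3, Thm. 1.6] [cite: Varesco2023, Rem. 2.10 and Rem. 2.16] -/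
theorem exists_eq_algebraMap_add_smul_of_mul_self_eq_natCast {q : ℕ} (hq : ¬ IsSquare q)
    (hirr : H.IsIrreducible) (hK3 : H.IsOfK3Type)
    (pol : H.Polarization) (hF : IsField H.endAlg)
    (hreal : ∀ (φ : H.endAlg →+* ℂ) (a : H.endAlg), starRingEnd ℂ (φ a) = φ a)
    (hV : Module.finrank ℚ V ≤ 11) (t : H.endAlg) (ht : t * t = algebraMap ℚ H.endAlg q) :
    ∀ e : H.endAlg, ∃ a b : ℚ, e = algebraMap ℚ H.endAlg a + b • t := by
  classical
  letI : Field H.endAlg := hF.toField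
  haveI : Module.Finite ℚ H.endAlg := finiteDimensional_endAlg H
  -- `t ∉ ℚ`
  have htnot : ∀ r : ℚ, algebraMap ℚ H.endAlg r ≠ t := by
    intro r hr
    have h := ht
    rw [← hr, ← map_mul] at h
    have hr2 : r * r = q := (algebraMap ℚ H.endAlg).injective h
    -- `√q ∉ ℚ`
    have hs : Real.sqrt q = ((|r| : ℚ) : ℝ) := by
      rw [Rat.cast_abs, ← Real.sqrt_sq_eq_abs, sq, ← Rat.cast_mul, hr2, Rat.cast_natCast]
    exact (irrational_sqrt_natCast_iff.2 hq).ne_rat _ hs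
  -- `[E:ℚ] ≤ 3`
  obtain ⟨m, hm, hdim⟩ := exists_three_le_finrank_eq_mul hirr hK3 pol hF hreal
  have hE3 : Module.finrank ℚ H.endAlg ≤ 3 := by
    by_contra hlt
    have : 4 * 3 ≤ Module.finrank ℚ H.endAlg * m := Nat.mul_le_mul (by omega) hm
    omega
  -- `[ℚ(t):ℚ] = 2` divides `[E:ℚ]`, so `[E:ℚ] = 2`
  have htint : IsIntegral ℚ t := .of_finite ℚ t
  have hmin : (minpoly ℚ t).natDegree = 2 := by
    have hdvd : minpoly ℚ t ∣ Polynomial.X ^ 2 - Polynomial.C (q : ℚ) := by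
      apply minpoly.dvd
      rw [map_sub, map_pow, Polynomial.aeval_X, Polynomial.aeval_C, sq, ht, sub_self]
    have hne : (Polynomial.X ^ 2 - Polynomial.C (q : ℚ)) ≠ 0 :=
      Polynomial.X_pow_sub_C_ne_zero (by norm_num) (q : ℚ)
    have hle : (minpoly ℚ t).natDegree ≤ 2 := by
      have h := Polynomial.natDegree_le_of_dvd hdvd hne
      rwa [Polynomial.natDegree_X_pow_sub_C] at h
    have hpos : 0 < (minpoly ℚ t).natDegree := minpoly.natDegree_pos htint
    have hne1 : (minpoly ℚ t).natDegree ≠ 1 := fun h1 => by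
      obtain ⟨q, hq⟩ := (minpoly.natDegree_eq_one_iff).1 h1
      exact htnot q hq
    omega
  have hKdim : Module.finrank ℚ ℚ⟮t⟯ = 2 := by rw [IntermediateField.adjoin.finrank htint, hmin]
  haveI : Module.Free ℚ ℚ⟮t⟯ := Module.Free.of_divisionRing ℚ ℚ⟮t⟯
  haveI : Module.Free ℚ⟮t⟯ H.endAlg := Module.Free.of_divisionRing ℚ⟮t⟯ H.endAlg
  have htower := Module.finrank_mul_finrank ℚ ℚ⟮t⟯ H.endAlg
  rw [hKdim] at htower
  have hE2 : Module.finrank ℚ H.endAlg = 2 := by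
    have hKE : 0 < Module.finrank ℚ⟮t⟯ H.endAlg := Module.finrank_pos
    omega
  -- `{1, t}` is a basis of `E`
  have hli : LinearIndependent ℚ ![(1 : H.endAlg), t] := by
    rw [LinearIndependent.pair_iff]
    intro a b hab
    by_cases hb : b = 0
    · subst hb
      simp only [zero_smul, add_zero, smul_eq_zero, one_ne_zero, or_false] at hab
      exact ⟨hab, rfl⟩
    · exfalso
      apply htnot (-(a / b))
      have h : b • t = -(a • (1 : H.endAlg)) := eq_neg_of_add_eq_zero_right hab
      rw [Algebra.algebraMap_eq_smul_one]
      apply smul_right_injective H.endAlg hb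
      change b • (-(a / b)) • (1 : H.endAlg) = b • t
      have hba : b * -(a / b) = -a := by field_simp
      rw [smul_smul, hba, neg_smul, h]
  have hcard : Fintype.card (Fin 2) = Module.finrank ℚ H.endAlg := by rw [Fintype.card_fin, hE2]
  let bE := basisOfLinearIndependentOfCardEqFinrank hli hcard
  intro e
  refine ⟨bE.repr e 0, bE.repr e 1, ?_⟩
  conv_lhs => rw [← bE.sum_repr e]
  rw [Fin.sum_univ_two]
  simp only [bE, coe_basisOfLinearIndependentOfCardEqFinrank, Matrix.cons_val_zero, Matrix.cons_val_one,
    Algebra.algebraMap_eq_smul_one]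

end Abstract

end Summit.HodgeConjecture.HodgeConjecture.Theorems.MarkmanPartnerTransport.NikulinIsogeny

end
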